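import Literature.IUT.LogVolume.PrimewiseLine
import Literature.IUT.LogVolume.TensorPacketShell
import Literature.IUT.LogVolume.TensorPacketTransport
import Literature.IUT.LogVolume.TensorPacketHull
import HarnessLib

/-!
# The tensor-packet model: a REAL `IndPacketModel` over a number field (Dupuy–Hilado Def. 3.6.1/3.6.3,
# §3.7, §4 intro, §4.7, §4.9, §4.12 — every interface axiom a theorem)

Dupuy–Hilado, arXiv:2004.13228 (pre-split text), read on the page (render chunks 8, 11–16): Def. 3.6.1
"`𝔸^{⊗ r+1}_{V̲,p} = ⊕_{(v_0,…,v_r)} K_{v̲_0} ⊗ ⋯ ⊗ K_{v̲_r}` … the tensor products are taken over `ℚ_p`", "the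
unique normalized log Haar measure … satisfying `log μ̄_{v⃗}(O_{v⃗}) = 0`"; §3.7 (action through the last tensor
factor, `ln|a|_p`); §4 intro (`I_{v⃗} = ⊗ (1/2p) log(O^×)`); §4.7 ((Ind1) = factor permutations, "fixes the
lattice"); §4.9 ((Ind2) = `Aut_{ℚ_p}(K_{v⃗} : I_{v⃗})`, "the measure of sets are preserved"); §4.12 (local hulls,
"the smallest possible module containing this regions", Rmk. 4.12.1).

THE MODEL. Input: for every prime `p` and every place `v ∈ V(F)_p`, a field `K_{v̲}` of the cell's norm-side
MLF class (`LocalFields F p`: a nontrivially normed field, normed `ℚ_p`-algebra, ultrametric, proper —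
standing for the completion of the extension `K/F` of [IUTchI] Def. 3.1 at a chosen place `v̲ | v`; e.g. the
finite subextensions of `ℚ̄_p` of `PadicSubfields.lean`). Output: `tensorPacketModel 𝔽 : IndPacketModel F`
(through `PrimewiseLine.IndPacketModel.ofPrimesLine` — real packets at primes, the valuation line at the junk
composite indices, never read by `ln ν̄_𝕃`; at a prime `p` its `p`-part IS `realPrimePacket p (𝔽 p hp)`):

* `X_{v⃗} := K_{v̲_0} ⊗_{ℚ_p} ⋯ ⊗_{ℚ_p} K_{v̲_j}` (abc-iut-S1's `PacketAlgebra`), `O_{v⃗} := (R_I)^∼`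
  (`normalizedPacket`), admissibility and `log μ̄_{v⃗}` the normalised log Haar measure through the chosen
  decomposition (`TensorPacketMeasure.lean`: `PacketAdm`, `packetLogμ` = S8's `packetLogVolume`);
* `Λ_v := K_{v̲}^×` with `LocalFields.ordv`: `ord_v(a) := −e_v·log‖a‖/log p` (the valuation normalised to `F_v`: `‖·‖` extends
  `|·|_p`, `e_v = e(v|p)`; values in `(e_v/e(K_{v̲}/ℚ_p))·ℤ`, i.e. FRACTIONAL on `K_{v̲} ⊋ F_v` as §3.9 /
  Thm. 3.10.1's `ℤ[1/d]`-coefficients require), peel action `a ↦ ι_j(a)·(−)`; **(3.7) with (3.4) is the THEOREM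
  `packetLogμ_iota_smul`** (`log μ̄(ι(a)·U) = log‖a‖ + log μ̄(U)` and `log‖a‖ = −ord_v(a)·ln|κ(v)|/n_v`);
* `shell := I_{v⃗} = (2p)^{−(j+1)}·log_p(R_I^×)` (`logShell`, admissible: `TensorPacketShell.lean`);
* (Ind1) `perm σ := permAlgEquiv` (`TensorPacketTransport.lean`; `perm_one`, "fixes the lattice", `O ↦ O`,
  and the MODELLING fields `perm_adm`/`logμ_perm` of the interface now THEOREMS of Haar transport);
* (Ind2) `G₂ := indTwo = Aut_{ℚ_p}(V : log_p(R_I^×))` acting through linear automorphisms (`smul_adm`,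
  **`logμ_smul` = DH's footnote, a THEOREM**, `smul_shell`);
* `hullLoc := packetHull` (abc-iut-S2's `(R_I)^∼`-span = smallest polydisc through any decomposition on bounded
  regions, `TensorPacketHull.lean`).
Consequently every theorem of `DegreeVolumeConversion`/`MultiradialRegion`/`LDHCor312*` (Dupuy–Hilado
Thm. 3.10.1, (Ind1)/(Ind2)-invariance of `ln ν̄_𝕃`, the (1.1)-bookkeeping) holds in this model with NO interface
axiom left — e.g. `lnνL_region_tensorPacketModel`.

[cite: DupuyHilado2025, Def. 3.6.1, Def. 3.6.3, §3.7, §4.7, §4.9, §4.12]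
[cite: Mochizuki2012, IUTchIII Thm. 3.11 (i) (Ind1)(Ind2) p. 154] An instance ≠ an endorsement: nothing here
bears on whether [IUTchIII] Thm. 3.11 licenses (1.1). Deliberately NOT here: the `DHData` over this model
(ideles realising the pilot divisors need `q̲_v = q_v^{1/2l} ∈ K_{v̲}`, [IUTchI] Ex. 3.2 (iv); summit-side file),
(Ind3), archimedean packets.
-/

noncomputable section

open MeasureTheory Set Metric NumberField IsDedekindDomain
open scoped TensorProduct NormedField Pointwise ENNReal

namespace Literature.IUT.LogVolume

open Literature.NumberTheory.GaloisRepresentations.Ultrametric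

variable (F : Type) [Field F] [NumberField F]

/-! ## The input: a `p`-adic field at every place over `p` -/

/-- **Local fields at the places over `p`**: for every `v ∈ V(F)_p` a field `K_{v̲}` of the norm-side MLF
class (nontrivially normed, normed `ℚ_p`-algebra — so `‖·‖` extends `|·|_p` —, ultrametric, proper), standing
for the completion at a place `v̲ | v` of the field `K ⊇ F` of initial theta data ([IUTchI] Def. 3.1; Dupuy–Hilado
§3.6 "`K_{v̲}`"). [cite: DupuyHilado2025, Def. 3.6.1] -/
structure LocalFields (p : ℕ) [Fact p.Prime] : Type 1 where
  /-- the field `K_{v̲}` at the place `v | p` -/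
  k : placesOver F p → Type
  /-- it is a nontrivially normed field -/
  [field : ∀ v, NontriviallyNormedField (k v)]
  /-- a normed `ℚ_p`-algebra -/
  [alg : ∀ v, NormedAlgebra ℚ_[p] (k v)]
  /-- ultrametric -/
  [ultra : ∀ v, IsUltrametricDist (k v)]
  /-- proper (locally compact) -/
  [proper : ∀ v, ProperSpace (k v)]

attribute [instance] LocalFields.field LocalFields.alg LocalFields.ultra LocalFields.proper

/-- **A local field family**: local fields at the places over every prime.
[cite: DupuyHilado2025, Def. 3.6.1] -/
def LocalFieldFamily : Type 1 := ∀ (p : ℕ) (hp : p.Prime), @LocalFields F _ _ p ⟨hp⟩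

variable {F}

/-! ## The valuation `ord_v` on `K_{v̲}^×`, normalised to `F_v` -/

section Ordv

variable {p : ℕ} [Fact p.Prime] (𝔽 : LocalFields F p)

/-- **`ord_v(a) := −e_v·log‖a‖/log p`** for `a ∈ K_{v̲}^×`: the valuation normalised to `F_v` (`ord_v(π_v) = 1`
for a uniformizer `π_v` of `F_v`, since `‖π_v‖ = p^{−1/e_v}`; Dupuy–Hilado §2.4.2 "`ord_L = e(L/K)·ord_K`",
rational-valued on `K_{v̲}`). [cite: DupuyHilado2025, §2.4.2, §3.4] -/
def LocalFields.ordv {v : placesOver F p} (a : (𝔽.k v)ˣ) : ℝ :=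
  -(ramIdx F v.1 : ℝ) * Real.log ‖(a : 𝔽.k v)‖ / Real.log p

/-- **(3.4)**: `log‖a‖ = ln|a|_p = −ord_v(a)·ln|κ(v)|/n_v` (`ln|κ(v)| = f_v log p`, `n_v = e_v f_v`).
[cite: DupuyHilado2025, §3.4] -/
theorem LocalFields.log_norm_eq_neg_ordv {v : placesOver F p} (a : (𝔽.k v)ˣ) :
    Real.log ‖(a : 𝔽.k v)‖ = -(𝔽.ordv a) * logNorm F v.1 / localDegree F v.1 := by
  have hp : (1 : ℝ) < p := by exact_mod_cast (Fact.out : p.Prime).one_lt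
  have hlogp : Real.log p ≠ 0 := (Real.log_pos hp).ne'
  have he : (ramIdx F v.1 : ℝ) ≠ 0 := by exact_mod_cast ramIdx_ne_zero F v.1
  have hf : (resDeg F v.1 : ℝ) ≠ 0 := by exact_mod_cast resDeg_ne_zero F v.1
  have hv : residueChar F v.1 = p := (mem_placesOver_iff_residueChar v.1).mp v.2
  rw [logNorm_eq, hv, localDegree, Nat.cast_mul, LocalFields.ordv]
  field_simp

/-- `ord_v(ab) = ord_v(a) + ord_v(b)`. [cite: DupuyHilado2025, §2.4.2] -/
theorem LocalFields.ordv_mul {v : placesOver F p} (a b : (𝔽.k v)ˣ) : 𝔽.ordv (a * b) = 𝔽.ordv a + 𝔽.ordv b := by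
  simp only [LocalFields.ordv, Units.val_mul, norm_mul]
  rw [Real.log_mul (norm_ne_zero_iff.mpr a.ne_zero) (norm_ne_zero_iff.mpr b.ne_zero)]
  ring

/-- `ord_v(p) = e_v` (`‖p‖ = p^{−1}`). [cite: DupuyHilado2025, §2.4.2] -/
theorem LocalFields.ordv_prime {v : placesOver F p} :
    𝔽.ordv (Units.mk0 (p : 𝔽.k v) (prime_ne_zero p (𝔽.k v))) = ramIdx F v.1 := by
  have hp : (1 : ℝ) < p := by exact_mod_cast (Fact.out : p.Prime).one_lt
  have hlogp : Real.log p ≠ 0 := (Real.log_pos hp).ne'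
  rw [LocalFields.ordv, Units.val_mk0, norm_prime, Real.log_inv]
  field_simp

end Ordv

/-! ## The real packet at a prime -/

section Real

variable (p : ℕ) [Fact p.Prime] (𝔽 : LocalFields F p)

/-- The peel action is the pointwise action of `ι_j(a)`: `(ι_j(a)·−)''U = ι_j(a)·U`. [cite: DupuyHilado2025, §3.7] -/
private theorem image_mul_eq_smul {j : ℕ} {e : Fin (j + 1) → placesOver F p}
    (a : (𝔽.k (e (Fin.last j)))ˣ) (U : Set (PacketAlgebra p (fun i => 𝔽.k (e i)))) :
    (fun x => iota p (fun i => 𝔽.k (e i)) (Fin.last j) (a : 𝔽.k (e (Fin.last j))) * x) '' U =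
      iota p (fun i => 𝔽.k (e i)) (Fin.last j) (a : 𝔽.k (e (Fin.last j))) • U := by
  rw [← image_smul]
  rfl

/-- (Ind1) fixes DH's log-shell: `perm(I_{v⃗∘σ}) = I_{v⃗}` (it maps `log_p(R^×)` onto `log_p(R^×)` and commutes with
the scalar `(2p)^{−(j+1)}`). [cite: DupuyHilado2025, §4.7] -/
theorem image_logShell_perm {j : ℕ} (σ : Equiv.Perm (Fin (j + 1))) (e : Fin (j + 1) → placesOver F p) :
    permAlgEquiv p (fun i => 𝔽.k (e i)) σ '' logShell p (fun i => 𝔽.k (e (σ i))) =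
      logShell p (fun i => 𝔽.k (e i)) := by
  simp only [logShell]
  rw [image_const_smul_perm, image_logPacket_perm]

/-- **The real packet at the prime `p`**: summands `K_{v̲_0} ⊗_{ℚ_p} ⋯ ⊗ K_{v̲_j}`, `O = (R_I)^∼`, normalised log
Haar measure, `Λ_v = K_{v̲}^×` with `ord_v`, peel action `ι_j(a)·`, log-shell `(2p)^{−(j+1)}·log_p(R_I^×)`, (Ind1)
factor permutations, (Ind2) `Aut_{ℚ_p}(V : log_p(R_I^×))`, hull = `(R_I)^∼`-span — and every axiom of the
interface DISCHARGED by the theorems of `TensorPacketMeasure`/`Shell`/`Transport`.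
[cite: DupuyHilado2025, Def. 3.6.1, §3.7, §4.7, §4.9, §4.12] -/
def realPrimePacket : PrimePacket F p where
  X j e := PacketAlgebra p (fun i => 𝔽.k (e i))
  adm {_ e} A := PacketAdm p (fun i => 𝔽.k (e i)) A
  logμ {_ e} A := packetLogμ p (fun i => 𝔽.k (e i)) A
  logμ_mono {_ e _ _} hA hB h := packetLogμ_mono p (fun i => 𝔽.k (e i)) hA hB h
  O j e := (normalizedPacket p (fun i => 𝔽.k (e i)) : Set (PacketAlgebra p (fun i => 𝔽.k (e i))))
  O_adm j e := packetAdm_normalizedPacket p (fun i => 𝔽.k (e i))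
  logμ_O j e := packetLogμ_normalizedPacket p (fun i => 𝔽.k (e i))
  Λ v := (𝔽.k v)ˣ
  ordv {_} a := 𝔽.ordv a
  peel {j e} a x := iota p (fun i => 𝔽.k (e i)) (Fin.last j) (a : 𝔽.k (e (Fin.last j))) * x
  peel_adm {j e} a U hU := by
    rw [image_mul_eq_smul]
    exact packetAdm_iota_smul p (fun i => 𝔽.k (e i)) (Fin.last j) a.ne_zero hU
  logμ_peel {j e} a U hU := by
    rw [image_mul_eq_smul, packetLogμ_iota_smul p (fun i => 𝔽.k (e i)) (Fin.last j) a.ne_zero hU,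
      LocalFields.log_norm_eq_neg_ordv]
  shell j e := logShell p (fun i => 𝔽.k (e i))
  shell_adm j e := packetAdm_logShell p (fun i => 𝔽.k (e i))
  perm {j} σ e := (permAlgEquiv p (fun i => 𝔽.k (e i)) σ).toEquiv
  perm_one {j} e x := permAlgEquiv_one_apply p (fun i => 𝔽.k (e i)) x
  perm_adm {j} σ e U hU := packetAdm_image_perm p (fun i => 𝔽.k (e i)) σ hU
  logμ_perm {j} σ e U hU := packetLogμ_image_perm p (fun i => 𝔽.k (e i)) σ U
  perm_shell {j} σ e := image_logShell_perm p 𝔽 σ e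
  G₂ j e := indTwo p (fun i => 𝔽.k (e i))
  smul_adm {_ e} g U hU := packetAdm_indTwo_smul p (fun i => 𝔽.k (e i)) g hU
  logμ_smul {_ e} g U hU := packetLogμ_indTwo_smul p (fun i => 𝔽.k (e i)) g U
  smul_shell {_ e} g := indTwo_smul_logShell p (fun i => 𝔽.k (e i)) g
  hullLoc j e := packetHull p (fun i => 𝔽.k (e i))

/-! ### What the fields of the real packet are (for consumers) -/

/-- The summand IS the tensor packet `⊗_{ℚ_p} K_{v̲_i}`. [cite: DupuyHilado2025, Def. 3.6.1] -/
theorem realPrimePacket_X (j : ℕ) (e : Fin (j + 1) → placesOver F p) :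
    (realPrimePacket p 𝔽).X j e = PacketAlgebra p (fun i => 𝔽.k (e i)) := rfl

/-- Admissibility IS `PacketAdm`. [cite: DupuyHilado2025, Def. 3.5.1] -/
theorem realPrimePacket_adm {j : ℕ} {e : Fin (j + 1) → placesOver F p} (A : Set ((realPrimePacket p 𝔽).X j e)) :
    (realPrimePacket p 𝔽).adm A ↔ PacketAdm p (fun i => 𝔽.k (e i)) A := Iff.rfl

/-- `log μ̄` IS `packetLogμ` (= S8's `packetLogVolume` along the chosen decomposition).
[cite: DupuyHilado2025, Def. 3.6.1] -/
theorem realPrimePacket_logμ {j : ℕ} {e : Fin (j + 1) → placesOver F p} (A : Set ((realPrimePacket p 𝔽).X j e)) :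
    (realPrimePacket p 𝔽).logμ A = packetLogμ p (fun i => 𝔽.k (e i)) A := rfl

/-- `O` IS `(R_I)^∼`. [cite: DupuyHilado2025, §2.4.5] -/
theorem realPrimePacket_O (j : ℕ) (e : Fin (j + 1) → placesOver F p) :
    (realPrimePacket p 𝔽).O j e =
      (normalizedPacket p (fun i => 𝔽.k (e i)) : Set (PacketAlgebra p (fun i => 𝔽.k (e i)))) := rfl

/-- The log-shell IS `(2p)^{−(j+1)}·log_p(R_I^×)`. [cite: DupuyHilado2025, §4 (intro)] -/
theorem realPrimePacket_shell (j : ℕ) (e : Fin (j + 1) → placesOver F p) :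
    (realPrimePacket p 𝔽).shell j e = logShell p (fun i => 𝔽.k (e i)) := rfl

/-- The local hull IS the `(R_I)^∼`-span. [cite: DupuyHilado2025, §4.12] -/
theorem realPrimePacket_hullLoc (j : ℕ) (e : Fin (j + 1) → placesOver F p) :
    (realPrimePacket p 𝔽).hullLoc j e = packetHull p (fun i => 𝔽.k (e i)) := rfl

/-- The peel action of `a ∈ K_{v̲_j}^×` IS multiplication by `ι_j(a)`: `peel a '' U = ι_j(a)·U`.
[cite: DupuyHilado2025, §3.7] -/
theorem realPrimePacket_peel_image {j : ℕ} {e : Fin (j + 1) → placesOver F p} (a : (𝔽.k (e (Fin.last j)))ˣ)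
    (U : Set (PacketAlgebra p (fun i => 𝔽.k (e i)))) :
    (realPrimePacket p 𝔽).peel a '' U =
      iota p (fun i => 𝔽.k (e i)) (Fin.last j) (a : 𝔽.k (e (Fin.last j))) • U :=
  image_mul_eq_smul p 𝔽 a U

/-- (Ind2)-elements act through their linear automorphism: `g • A = g(A)`. [cite: DupuyHilado2025, §4.9] -/
theorem realPrimePacket_smul {j : ℕ} {e : Fin (j + 1) → placesOver F p} (g : (realPrimePacket p 𝔽).G₂ j e)
    (A : Set ((realPrimePacket p 𝔽).X j e)) :
    g • A = ((indTwo p (fun i => 𝔽.k (e i))).subtype g :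
      PacketAlgebra p (fun i => 𝔽.k (e i)) ≃ₗ[ℚ_[p]] PacketAlgebra p (fun i => 𝔽.k (e i))) '' A :=
  indTwo_smul_set p (fun i => 𝔽.k (e i)) g A

end Real

/-! ## The model over all primes -/

section Model

variable (𝔽 : LocalFieldFamily F)

/-- **The tensor-packet model** of Dupuy–Hilado's `𝕃` over the number field `F`: the real packet at every
prime (and the valuation line at composite indices, which no log-measure ever reads — `PrimewiseLine`).
[cite: DupuyHilado2025, Def. 3.6.1, Def. 3.6.3] -/
def tensorPacketModel : IndPacketModel F :=
  IndPacketModel.ofPrimesLine fun p hp => @realPrimePacket F _ _ p ⟨hp⟩ (𝔽 p hp)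

/-- **At a prime `p` the model IS the real packet** (transfer lemma for per-prime statements).
[cite: DupuyHilado2025, Def. 3.6.3] -/
theorem primePart_tensorPacketModel {p : ℕ} (hp : p.Prime) :
    (tensorPacketModel 𝔽).primePart p = @realPrimePacket F _ _ p ⟨hp⟩ (𝔽 p hp) :=
  IndPacketModel.primePart_ofPrimesLine _ hp

/-- At a composite index the model is the valuation line. [cite: DupuyHilado2025, Def. 3.6.3] -/
theorem primePart_tensorPacketModel_of_not_prime {p : ℕ} (hp : ¬ p.Prime) :
    (tensorPacketModel 𝔽).primePart p = PrimePacket.line F p :=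
  IndPacketModel.primePart_ofPrimesLine_of_not_prime _ hp

/-- Transfer: a property of the real packet at `p` is a property of the model's `p`-part.
[cite: DupuyHilado2025, Def. 3.6.3] -/
theorem tensorPacketModel_elim {p : ℕ} (hp : p.Prime) (C : PrimePacket F p → Prop)
    (h : C (@realPrimePacket F _ _ p ⟨hp⟩ (𝔽 p hp))) : C ((tensorPacketModel 𝔽).primePart p) :=
  IndPacketModel.ofPrimesLine_elim _ hp C h

/-- **Dupuy–Hilado Thm. 3.10.1 in the tensor-packet model, unconditionally**: for every lgp-idele `t` and
finite set of primes `T`, `ln ν̄_𝕃(O_𝕃(−div_T t)) = −deĝ̲_lgp(div_T t)` — the interface theorem with ALL its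
axioms ((3.4), (3.7), normalisation) now theorems of Haar measure on tensor packets.
[cite: DupuyHilado2025, Thm. 3.10.1] -/
theorem lnνL_region_tensorPacketModel {lstar : ℕ} (t : (tensorPacketModel 𝔽).LgpIdele lstar)
    (T : Finset ℕ) (hT : ∀ p ∈ T, p.Prime) :
    (tensorPacketModel 𝔽).lnνL lstar T ((tensorPacketModel 𝔽).region t) =
      -LgpDivisor.ndegLgp (PacketModel.LgpIdele.div (tensorPacketModel 𝔽).toPacketModel t T) :=
  (tensorPacketModel 𝔽).lnνL_region_eq_neg_ndegLgp t T hT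

/-- **(Ind1)/(Ind2) preserve `ln ν̄_𝕃` in the tensor-packet model** — the invariance `MultiradialRegion.lnνL_UTheta`
with its two modelling fields now theorems: every possible image `g·σ·(O_𝕃(−P_Θ))^{Ind3}` has the log-measure
of `(O_𝕃(−P_Θ))^{Ind3}`. [cite: DupuyHilado2025, §4.7, §4.9, §4.11] -/
theorem lnνL_UTheta_tensorPacketModel {lstar : ℕ} {t : (tensorPacketModel 𝔽).LgpIdele lstar}
    (D : (tensorPacketModel 𝔽).Ind3Datum t)
    (lam : (tensorPacketModel 𝔽).Ind2Elt × (tensorPacketModel 𝔽).Ind1Elt) (T : Finset ℕ) :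
    (tensorPacketModel 𝔽).lnνL lstar T ((tensorPacketModel 𝔽).UTheta D lam) =
      (tensorPacketModel 𝔽).lnνL lstar T D.bare3 :=
  (tensorPacketModel 𝔽).lnνL_UTheta D lam T

end Model

/-! ## Non-vacuity: a local field family exists over every number field -/

/-- The family `K_{v̲} := ℚ_p` at every place (an instance of the setting: `PadicSubfields`/Mathlib). It shows
`LocalFieldFamily F` inhabited; the fields of initial theta data are finite extensions of these.
[cite: DupuyHilado2025, Def. 3.6.1] -/
def LocalFieldFamily.padic : LocalFieldFamily F := fun p hp =>
  haveI : Fact p.Prime := ⟨hp⟩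
  { k := fun _ => ℚ_[p] }

/-- The tensor-packet model exists over every number field. [cite: DupuyHilado2025, Def. 3.6.1] -/
theorem nonempty_indPacketModel : Nonempty (IndPacketModel F) := ⟨tensorPacketModel LocalFieldFamily.padic⟩

end Literature.IUT.LogVolume

end
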